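import Literature.Analysis.FunctionSpaces.TorusAnalyticSeminorm
import HarnessLib

/-!
# The product estimate with Armstrong–Vicol's printed constant: `⟦fg⟧_{n,R} ≤ 4 C_f C_g`

Analysis/FunctionSpaces proof file (theorems only; no definitions, no named facts). Armstrong–Vicol
(*Anomalous diffusion by fractal homogenization*, Ann. PDE 11 (2025) = arXiv:2305.05048, App. A
Lemma 7.1, p. 70) state the product estimate for the analyticity seminorms
`⟦f⟧_{n,R} = (n+1)²/(n! Rⁿ) sup_{|α|=n} ‖∂^α f‖_∞` with the universal constant `4`:

  `⟦fg⟧_{n,R} ≤ 4 (max_{j≤n} ⟦f⟧_{j,R}) (max_{j≤n} ⟦g⟧_{j,R})`,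

"since `Σ_{k=0}^{n} (n+1)² (k+1)^{-2} (n−k+1)^{-2} ≤ 4` for all `n ≥ 0`". The tree's
`Torus.dnorm_mul_le` (`TorusAnalyticSeminorm`) proved the elementary constant `8`; the downstream
constants of App. A (Prop. 7.10: `(d−1)!(20d)^{d−1}`, Prop. 7.11: `6d`) are computed with `4`, so the
printed constant is needed to discharge those facts as stated. This file proves the numerical
inequality with constant `4` and the two product estimates with the printed constant:

* `Torus.sum_weight_le_four` — `Σ_{k=0}^{n} (n+1)²/((k+1)²(n−k+1)²) ≤ 4`. Proof: with `a = k+1`,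
  `b = n−k+1`, `a + b = n + 2`, one has `(n+1)/(ab) = ((n+1)/(n+2))(1/a + 1/b)`, so the sum equals
  `((n+1)/(n+2))² (2 S₂ + 4 H/(n+2))` with `S₂ = Σ_{k≤n} (k+1)^{-2} ≤ 5/3` (telescoping against
  `1/((k+½)(k+3/2))`) and `H = Σ_{k≤n} (k+1)^{-1} ≤ 49/20 + (n−5)/7` (the first six terms exactly, the
  rest by `1/7` each); the resulting rational inequality is polynomial. (The true supremum is `≈ 3.52`.)
* `Torus.dnorm_mul_le_four`, `Torus.dnorm_smul_le_four` — Lemma 7.1 as printed (real × real and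
  real × vector), from the summed forms `Torus.dnorm_mul_le_sum` / `Torus.dnorm_smul_le_sum`.

## Mathlib / tree search

`Torus.dnorm_mul_le_sum`, `Torus.dnorm_smul_le_sum`, `Torus.sum_weight_le_eight`, `Torus.dnorm_mul_le`
(constant 8) exist (`TorusAnalyticSeminorm`); no constant-4 version (`rg "≤ 4 \* Cf" Literature`: none).

## References

* S. Armstrong, V. Vicol, *Anomalous diffusion by fractal homogenization*, Ann. PDE 11 (2025),
  arXiv:2305.05048, App. A Lemma 7.1 and its proof ("`Σ (n+1)²(k+1)^{-2}(n−k+1)^{-2} ≤ 4`"), p. 70.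
  [`ArmstrongVicol2025`]
-/

noncomputable section

open Set Function Finset

namespace Literature.Analysis.FunctionSpaces

namespace Torus

variable {d : Type*} [Fintype d] [DecidableEq d]
variable {F : Type*} [NormedAddCommGroup F] [NormedSpace ℝ F]

/-! ## §1 The numerical inequality `Σ_{k=0}^{n} (n+1)²/((k+1)²(n−k+1)²) ≤ 4` -/

/-- `Σ_{k=0}^{N} 1/(k+1)² ≤ 5/3 − 1/(N + 3/2)` (telescoping: `1/(k+1)² ≤ 1/(k+½) − 1/(k+3/2)` for
`k ≥ 1`). [folklore] -/
private theorem sum_inv_sq_le (N : ℕ) :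
    ∑ k ∈ Finset.range (N + 1), 1 / (((k : ℝ) + 1) ^ 2) ≤ 5 / 3 - 1 / ((N : ℝ) + 3 / 2) := by
  induction N with
  | zero => norm_num
  | succ N ih =>
    rw [Finset.sum_range_succ]
    push_cast
    have hN : (0 : ℝ) < (N : ℝ) + 3 / 2 := by positivity
    have hN1 : (0 : ℝ) < (N : ℝ) + 1 + 3 / 2 := by positivity
    have h1 : 1 / ((N : ℝ) + 1 + 1) ^ 2 ≤ 1 / ((N : ℝ) + 3 / 2) - 1 / ((N : ℝ) + 1 + 3 / 2) := by
      rw [div_sub_div _ _ hN.ne' hN1.ne', div_le_div_iff₀ (by positivity) (by positivity)]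
      nlinarith
    linarith

/-- `H_{N+1} = Σ_{k=0}^{N} 1/(k+1) ≤ 49/20 + (N − 5)/7` (the first six terms exactly, every further
term is at most `1/7`). [folklore] -/
private theorem harmonic_le (N : ℕ) :
    ∑ k ∈ Finset.range (N + 1), 1 / ((k : ℝ) + 1) ≤ 49 / 20 + ((N : ℝ) - 5) / 7 := by
  induction N with
  | zero => norm_num
  | succ N ih =>
    rw [Finset.sum_range_succ]
    rcases Nat.lt_or_ge N 5 with hN | hN
    · -- small cases (`N ≤ 4`): exact values
      interval_cases N <;> norm_num [Finset.sum_range_succ]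
    · have hN6 : (6 : ℝ) ≤ (N : ℝ) + 1 := by
        have : 6 ≤ N + 1 := by omega
        exact_mod_cast this
      have h1 : 1 / ((N : ℝ) + 1 + 1) ≤ 1 / 7 := by
        rw [div_le_div_iff₀ (by positivity) (by norm_num)]
        linarith
      push_cast at ih ⊢
      linarith

/-- Reflection of the range sum: `Σ_{k≤n} φ(n−k) = Σ_{k≤n} φ(k)`. [folklore] -/
private theorem sum_range_reflect' (n : ℕ) (φ : ℕ → ℝ) :
    ∑ k ∈ Finset.range (n + 1), φ (n - k) = ∑ k ∈ Finset.range (n + 1), φ k := by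
  rw [← Finset.sum_range_reflect]
  refine Finset.sum_congr rfl fun k hk => ?_
  have hk' : k ≤ n := Nat.lt_succ_iff.1 (Finset.mem_range.1 hk)
  congr 1
  omega

/-- **The numerical factor with Armstrong–Vicol's constant**:
`Σ_{k=0}^{n} (n+1)²/((k+1)²(n−k+1)²) ≤ 4` (stated in the proof of App. A Lemma 7.1; the supremum over
`n` is `≈ 3.52`). [cite: ArmstrongVicol2025, App. A Lemma 7.1 (proof)] -/
theorem sum_weight_le_four (n : ℕ) :
    ∑ k ∈ Finset.range (n + 1), ((n : ℝ) + 1) ^ 2 / ((((k : ℝ) + 1) ^ 2) * (((n - k : ℕ) : ℝ) + 1) ^ 2) ≤ 4 := by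
  -- abbreviations
  set S₂ : ℝ := ∑ k ∈ Finset.range (n + 1), 1 / (((k : ℝ) + 1) ^ 2) with hS₂
  set H : ℝ := ∑ k ∈ Finset.range (n + 1), 1 / ((k : ℝ) + 1) with hH
  have hn2 : (0 : ℝ) < (n : ℝ) + 2 := by positivity
  -- termwise: `(n+1)²/(a²b²) = ((n+1)/(n+2))² (1/a + 1/b)²` with `a = k+1`, `b = n-k+1`, `a + b = n + 2`
  have hterm : ∀ k ∈ Finset.range (n + 1),
      ((n : ℝ) + 1) ^ 2 / ((((k : ℝ) + 1) ^ 2) * (((n - k : ℕ) : ℝ) + 1) ^ 2) =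
        (((n : ℝ) + 1) / ((n : ℝ) + 2)) ^ 2 *
          (1 / ((k : ℝ) + 1) ^ 2 + 1 / (((n - k : ℕ) : ℝ) + 1) ^ 2 +
            2 / ((n : ℝ) + 2) * (1 / ((k : ℝ) + 1) + 1 / (((n - k : ℕ) : ℝ) + 1))) := by
    intro k hk
    have hk' : k ≤ n := Nat.lt_succ_iff.1 (Finset.mem_range.1 hk)
    have hcast : (((n - k : ℕ) : ℝ)) = (n : ℝ) - (k : ℝ) := by rw [Nat.cast_sub hk']
    set a : ℝ := (k : ℝ) + 1 with ha
    set b : ℝ := ((n - k : ℕ) : ℝ) + 1 with hb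
    have ha0 : 0 < a := by positivity
    have hb0 : 0 < b := by positivity
    have hab : a + b = (n : ℝ) + 2 := by rw [ha, hb, hcast]; ring
    have hn1 : (n : ℝ) + 1 = a + b - 1 := by linarith
    rw [← hab, hn1]
    field_simp
    ring
  rw [Finset.sum_congr rfl hterm, ← Finset.mul_sum, Finset.sum_add_distrib, Finset.sum_add_distrib,
    ← Finset.mul_sum, Finset.sum_add_distrib]
  rw [sum_range_reflect' n (fun k => 1 / ((k : ℝ) + 1) ^ 2), sum_range_reflect' n (fun k => 1 / ((k : ℝ) + 1))]
  rw [← hS₂, ← hH]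
  -- numerical bounds
  have hS : S₂ ≤ 5 / 3 := by
    have := sum_inv_sq_le n
    have h0 : (0 : ℝ) < (n : ℝ) + 3 / 2 := by positivity
    have : 0 ≤ 1 / ((n : ℝ) + 3 / 2) := by positivity
    linarith
  have hHle : H ≤ 49 / 20 + ((n : ℝ) - 5) / 7 := harmonic_le n
  have hH0 : 0 ≤ H := Finset.sum_nonneg fun k _ => by positivity
  have hS0 : 0 ≤ S₂ := Finset.sum_nonneg fun k _ => by positivity
  -- the polynomial inequality: `x²((10/3)(x+1) + 4H') ≤ 4(x+1)³` with `x = n+1`, `H' ≤ 49/20 + (x-6)/7`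
  have hx : (1 : ℝ) ≤ (n : ℝ) + 1 := by
    have : (0 : ℝ) ≤ n := Nat.cast_nonneg n
    linarith
  rw [show (((n : ℝ) + 1) / ((n : ℝ) + 2)) ^ 2 * (S₂ + S₂ + 2 / ((n : ℝ) + 2) * (H + H)) =
      ((n : ℝ) + 1) ^ 2 * (2 * S₂ * ((n : ℝ) + 2) + 4 * H) / ((n : ℝ) + 2) ^ 3 by
    field_simp
    ring]
  rw [div_le_iff₀ (by positivity)]
  have h1 : ((n : ℝ) + 1) ^ 2 * (2 * S₂ * ((n : ℝ) + 2) + 4 * H) ≤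
      ((n : ℝ) + 1) ^ 2 * (2 * (5 / 3) * ((n : ℝ) + 2) + 4 * (49 / 20 + ((n : ℝ) - 5) / 7)) := by
    refine mul_le_mul_of_nonneg_left ?_ (by positivity)
    nlinarith
  refine h1.trans ?_
  nlinarith [hx, sq_nonneg ((n : ℝ) + 1)]

/-! ## §2 Lemma 7.1 with the printed constant -/

/-- **Product estimate (Armstrong–Vicol, App. A Lemma 7.1), printed constant**: if `⟦f⟧_{j,R} ≤ C_f`
and `⟦g⟧_{j,R} ≤ C_g` for all `j ≤ n` (`R > 0`), then `⟦fg⟧_{n,R} ≤ 4 C_f C_g`.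
[cite: ArmstrongVicol2025, App. A Lemma 7.1] -/
theorem dnorm_mul_le_four {n : ℕ} {R Cf Cg : ℝ} {f g : UnitAddTorus d → ℝ} (hf : IsSmooth f) (hg : IsSmooth g)
    (hR : 0 < R) (hCf : ∀ j ≤ n, dnorm j R f ≤ Cf) (hCg : ∀ j ≤ n, dnorm j R g ≤ Cg) :
    dnorm n R (fun y => f y * g y) ≤ 4 * Cf * Cg := by
  have hCf0 : 0 ≤ Cf := (dnorm_nonneg 0 hR.le f).trans (hCf 0 (Nat.zero_le _))
  have hCg0 : 0 ≤ Cg := (dnorm_nonneg 0 hR.le g).trans (hCg 0 (Nat.zero_le _))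
  refine (dnorm_mul_le_sum hf hg hR hCf hCg).trans ?_
  calc Cf * Cg * ∑ k ∈ Finset.range (n + 1), ((n : ℝ) + 1) ^ 2 / ((((k : ℝ) + 1) ^ 2) * (((n - k : ℕ) : ℝ) + 1) ^ 2)
      ≤ Cf * Cg * 4 := mul_le_mul_of_nonneg_left (sum_weight_le_four n) (mul_nonneg hCf0 hCg0)
    _ = 4 * Cf * Cg := by ring

/-- **Product estimate for `f • g`, printed constant** (Armstrong–Vicol, App. A Lemma 7.1, scalar
times vector): `⟦f g⟧_{n,R} ≤ 4 C_f C_g` given `⟦f⟧_{j,R} ≤ C_f`, `⟦g⟧_{j,R} ≤ C_g` for `j ≤ n`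
(`R > 0`). [cite: ArmstrongVicol2025, App. A Lemma 7.1] -/
theorem dnorm_smul_le_four {n : ℕ} {R Cf Cg : ℝ} {f : UnitAddTorus d → ℝ} {g : UnitAddTorus d → F}
    (hf : IsSmooth f) (hg : IsSmooth g) (hR : 0 < R) (hCf : ∀ j ≤ n, dnorm j R f ≤ Cf)
    (hCg : ∀ j ≤ n, dnorm j R g ≤ Cg) :
    dnorm n R (fun y => f y • g y) ≤ 4 * Cf * Cg := by
  have hCf0 : 0 ≤ Cf := (dnorm_nonneg 0 hR.le f).trans (hCf 0 (Nat.zero_le _))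
  have hCg0 : 0 ≤ Cg := (dnorm_nonneg 0 hR.le g).trans (hCg 0 (Nat.zero_le _))
  refine (dnorm_smul_le_sum hf hg hR hCf hCg).trans ?_
  calc Cf * Cg * ∑ k ∈ Finset.range (n + 1), ((n : ℝ) + 1) ^ 2 / ((((k : ℝ) + 1) ^ 2) * (((n - k : ℕ) : ℝ) + 1) ^ 2)
      ≤ Cf * Cg * 4 := mul_le_mul_of_nonneg_left (sum_weight_le_four n) (mul_nonneg hCf0 hCg0)
    _ = 4 * Cf * Cg := by ring

/-- **Iterated form over all orders**: if `⟦f⟧_{j,R} ≤ C_f` and `⟦g⟧_{j,R} ≤ C_g` for all `j ≤ n`, then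
`⟦fg⟧_{j,R} ≤ 4 C_f C_g` for all `j ≤ n` (monotonicity of the hypothesis in the order), the form in
which Lemma 7.1 is iterated over products of several factors. [cite: ArmstrongVicol2025, App. A Lemma 7.1] -/
theorem dnorm_mul_le_four_of_le {n : ℕ} {R Cf Cg : ℝ} {f g : UnitAddTorus d → ℝ} (hf : IsSmooth f)
    (hg : IsSmooth g) (hR : 0 < R) (hCf : ∀ j ≤ n, dnorm j R f ≤ Cf) (hCg : ∀ j ≤ n, dnorm j R g ≤ Cg) :
    ∀ j ≤ n, dnorm j R (fun y => f y * g y) ≤ 4 * Cf * Cg := fun _ hj =>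
  dnorm_mul_le_four hf hg hR (fun i hi => hCf i (hi.trans hj)) (fun i hi => hCg i (hi.trans hj))

end Torus

end Literature.Analysis.FunctionSpaces

end
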